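import Summits.BirchSwinnertonDyer.BirchSwinnertonDyer.Theorems.ErratumRoadFiveNonSurjCornerHybridTwinLowerSupply
import Summits.BirchSwinnertonDyer.BirchSwinnertonDyer.Theorems.ErratumRoadFiveNonSurjCornerMaxRoadChaKernel
import HarnessLib

/-!
# Route `ErratumRoadFive` (rung K2), crux `NonSurjCorner` (item stmt-BirchSwinnertonDyer-19065), registered line `Lines/hybrid.lean`:
# THE HYBRID CUT (§1′ of `…HybridTwinLowerSupply`) RE-KEYED ON THE CHA-FREE MAX ROAD — `hChaU` (Cha 2005 Rmk. 25 upper, flag `Cha05-Rmk25-structure`)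
# replaced by {`casselsTate_levelInputs`, Gross 3.7 (2)} through corner3-p2 g11's kernel structure bound; every other input unchanged
# (cell `bsd-stepL`, seat `bsd-stepL-corner-p1` g17; `--supports stmt-BirchSwinnertonDyer-19065 --as helper`)

WHY THIS FILE. The hybrid glues #8–#15 all bottom out in this seat g16's §1′ theorem
`X11b.erratumRoadFive_nonSurjCorner_of_kolyZShaAn_of_kolyJMax_of_multiUpper_of_lowerLeafTwinDeep_of_twinMultDivisibility` (`…HybridTwinLowerSupply`,
p611044), which reads Cha's upper structure fact `hChaU` through the X₀(N) MAX road. `…MaxRoadChaKernel` (this seat g17) re-proved the MAX road with that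
fact replaced by corner3-p2 g11's KERNEL theorem (p628321), on a Friedberg–Hoffstein frame with `p` and `2` split. THIS FILE:
* §1 `missingUpperBoundAt_corner_of_jetchevDivisibility_of_twinLeafLower_of_casselsTate'` — that MAX road keyed on the line's ONE-PRIME
  Friedberg–Hoffstein fact (spent on the prime `2`; on the corner `p ∣ N` splits in every Heegner field for `N`), so conjunct 8 of slot 3 is unchanged;
* §2 `X11b.erratumRoadFive_nonSurjCorner_of_kolyZShaAn_of_kolyJMax_of_multiUpper_of_lowerLeafTwinDeep_of_twinMultDivisibility_of_casselsTate` — §1′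
  with the same replacement, token for token otherwise.
It is the base of glue #16 (slot 3: sixteen → FIFTEEN named facts, a pure projection: conjunct 16 dropped).

HONEST FRAMING: TWO THEOREMS (no definition, no named fact, no `sorry`); CONDITIONAL on every displayed binder; 19065 NOT closed; nothing booked; T7;
BSD is proved for no curve. Credit: lane B corner3-p2 g11, and the credits of p611044.
References (locators only): [cite: Cha2005, Thm. 21 and Rmk. 25] [cite: McCallumLMS1991, §5 Cor. 5.6] [cite: GrossLMS1991, §3 Prop. 3.7 (2)]
[cite: FriedbergHoffstein1995, Thm. B] [cite: JetchevSkinnerWan2017, §7.4.1–7.4.2] [cite: Jetchev2008, Thm. 1.1] [cite: Miller2011LMS, Def. 1.1].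
-/

set_option autoImplicit false
set_option linter.dupNamespace false -- `Summit.BirchSwinnertonDyer.BirchSwinnertonDyer` (summit = problem), tree-wide

noncomputable section

open scoped Classical NumberField MatrixGroups ModularForm

namespace Summit.BirchSwinnertonDyer.Rank1Residual.X11b

open CongruenceSubgroup WeierstrassCurve NumberField IsDedekindDomain Field
  Literature.NumberTheory.EllipticCurves
  Literature.NumberTheory.EllipticCurves.ModularForms
  Literature.NumberTheory.EllipticCurves.Rank1Residual
  Literature.NumberTheory.EllipticCurves.Rank1Residual.Typed
  Literature.NumberTheory.EllipticCurves.Wuthrich2014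
  Literature.NumberTheory.EllipticCurves.SteinWuthrich2013
  Literature.NumberTheory.EllipticCurves.GreenbergVatsal2000
  Literature.NumberTheory.EllipticCurves.EmertonPollackWeston2006
  Literature.NumberTheory.QuadraticFields.Quadratic
  Literature.NumberTheory.GaloisRepresentations
  Summit.BirchSwinnertonDyer.Rank1Residual
  Summit.BirchSwinnertonDyer.Rank1Residual.RankZeroHeightFree
  Summit.BirchSwinnertonDyer.Rank1Residual.X11b.Three.Koly
  Summit.BirchSwinnertonDyer.BirchSwinnertonDyer.Theorems

/-! ### §1 The Cha-free MAX road keyed on the ONE-PRIME Friedberg–Hoffstein fact (conjunct 8 of the line's slot 3, unchanged) -/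

/-- **`…MaxRoadChaKernel` §2 with the line's ONE-PRIME Friedberg–Hoffstein fact.** On the corner `p ∣ N` (multiplicative), so `p` splits in every Heegner field for `N`;
hence the one-prime fact `friedbergHoffstein_exists_heegnerField_split_twist_ne_zero` may be spent on the auxiliary prime `2` (to make `2` split, i.e.
«2 not inert»), and `p` split comes for free (`SatisfiesHeegnerHypothesis.of_dvd`). Same statement as §2 otherwise; with this form conjunct 8 of the
line's slot 3 stays as registered and slot 3 simply LOSES conjunct 16 (Cha upper): sixteen → fifteen, a pure projection. CONDITIONAL; nothing booked.
[cite: Cha2005, Thm. 21 and Rmk. 25 (pp. 173–175)] [cite: FriedbergHoffstein1995, Thm. B] [cite: JetchevSkinnerWan2017, §7.4.2] [cite: GrossLMS1991, §3 Prop. 3.7 (2)] -/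
theorem missingUpperBoundAt_corner_of_jetchevDivisibility_of_twinLeafLower_of_casselsTate'
    (hGZ : ∀ (N : ℕ) [NeZero N] (W : WeierstrassCurve ℚ) (K : Type) [Field K] [NumberField K],
      gross_zagier N W K)
    (hKo : ∀ (N : ℕ) [NeZero N] (W : WeierstrassCurve ℚ) (K : Type) [Field K] [NumberField K],
      kolyvagin N W K)
    (hGZK : rank_eq_analyticRank_of_analyticRank_le_one) (hmod : hasEntireLFunction_rat)
    (hnf : exists_isNewformOf) (hFHs : friedbergHoffstein_exists_heegnerField_split_twist_ne_zero)
    (hMaz : mazur_not_dvd_maninConstant_of_odd)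
    (hrec : ∀ (N : ℕ) [NeZero N] (W : WeierstrassCurve ℚ) (K : Type) [Field K] [NumberField K],
      heegnerPointOfConductor_one_galoisConj N W K)
    (hD36 : ∀ (N : ℕ) [NeZero N] (W : WeierstrassCurve ℚ) (K : Type) [Field K] [NumberField K],
      phi_heegnerTau_mem_singularModuliField N W K)
    (hCT : ∀ (K : Type) [Field K] [NumberField K], casselsTate_levelInputs K)
    (h372 : GrossLMS1991.prop37_2_frobeniusCongruence)
    (W : WeierstrassCurve ℚ) [W.IsElliptic] [W.IsGloballyMinimal] (p : ℕ) [Fact p.Prime]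
    (hX : ClassX11b W p) (hns : ¬ Surj W p) (h57 : p = 5 ∨ p = 7)
    (hv : p ∣ padicValInt p W.minimalDiscriminantInt) (hnr : ¬ Ram W p)
    -- the `≥`-half of the NON-SURJECTIVE X11a leaf twins at this `p` (hypothesis shape)
    (hLtw : ∀ (Wd : WeierstrassCurve ℚ) [Wd.IsElliptic] [Wd.IsGloballyMinimal],
      ClassX11a Wd p → ¬ Surj Wd p → p ∣ padicValInt p Wd.minimalDiscriminantInt →
      Typed.MissingLowerBoundAt Wd p)
    -- Jₚᶜ: the Jetchev direction `M_∞ ≥ t` on the corner frames of THIS pair (hypothesis shape)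
    (hJ : ∀ [NeZero (W.conductorNorm ℤ)] (K : Type) [Field K] [NumberField K]
      (Dt : ModularParametrizationData W (W.conductorNorm ℤ)) (β : ℤ) (ι : K →+* ℂ),
      IsImaginaryQuadratic K → 4 < (NumberField.discr K).natAbs →
      SatisfiesHeegnerHypothesis (W.conductorNorm ℤ) K → SatisfiesHeegnerHypothesis p K →
      (4 * (W.conductorNorm ℤ : ℤ)) ∣ β ^ 2 - NumberField.discr K → ¬ (p : ℤ) ∣ Dt.c →
      ∀ (s : ℕ), s ≤ padicValNat p W.tamagawaProduct →
        ∀ (n : ℕ) (d : KolyvaginHeegnerData Dt β ι n), Squarefree n →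
          (∀ ℓ ∈ n.primeFactors, Zhang2014.IsKolyvaginPrime (W.conductorNorm ℤ) W K p ℓ ∧
            s ≤ Zhang2014.kolyvaginIndex W p ℓ) → PDiv d p s) :
    Typed.MissingUpperBoundAt W p := by
  have hNS : integral_neronScaling_of_isGloballyMinimal :=
    integral_neronScaling_of_isGloballyMinimal_holds
  haveI : NeZero (W.conductorNorm ℤ) := ⟨(W.conductorNorm_pos_holds).ne'⟩
  have hp : p.Prime := Fact.out
  have hp5 : 5 ≤ p := by rcases h57 with h | h <;> omega
  have hp2 : p ≠ 2 := by omega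
  obtain ⟨hr, _, hmult, hirr⟩ := id hX
  -- a Manin-good parametrisation of level N_E (p² ∤ N)
  have hpN : ¬ p ^ 2 ∣ W.conductorNorm ℤ := not_sq_dvd_conductorNorm_of_mult W p hmult
  obtain ⟨D, hc⟩ := exists_modularParametrizationData_not_dvd hnf hMaz hNS W rfl hp hp2 hpN hirr
  -- the Friedberg–Hoffstein Heegner field: |d_K| > 4, every ℓ ∣ N_E and p split, L(E^{d_K},1) ≠ 0
  have hw : W.rootNumber = -1 := by
    rw [WeierstrassCurve.rootNumber_eq_neg_one_pow_analyticRank_of_exists_isNewformOf hnf W, hr]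
    norm_num
  -- the ONE-PRIME Friedberg–Hoffstein fact asked AT THE PRIME `2` («2 not inert in K» for corner3-p2's Cha kernel); `p ∣ N` splits by Heegner
  obtain ⟨K, _, _, hK, hdisc, hHN, hH2, hLt⟩ := hFHs W hw 2 Nat.prime_two 4
  have hHp : SatisfiesHeegnerHypothesis p K :=
    SatisfiesHeegnerHypothesis.of_dvd (dvd_conductorNorm_of_mult hmult) hHN
  have h2K : ¬ (Ideal.span {((2 : ℕ) : 𝓞 K)}).IsPrime := not_isPrime_span_two_of_satisfiesHeegnerHypothesis hH2
  haveI : IsTotallyComplex K := hK.2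
  have hneg : NumberField.discr K < 0 := discr_neg_of_finrank_eq_two K hK.1
  have h4lt : NumberField.discr K < -4 := by
    have habs : ((NumberField.discr K).natAbs : ℤ) = -NumberField.discr K :=
      Int.ofNat_natAbs_of_nonpos hneg.le
    have : (4 : ℤ) < ((NumberField.discr K).natAbs : ℤ) := by exact_mod_cast hdisc
    omega
  have h3 : NumberField.discr K ≠ -3 := by omega
  have h4 : NumberField.discr K ≠ -4 := by omega
  have hμ : ¬ p ∣ Units.torsionOrder K := by
    rw [Literature.NumberTheory.DiophantineGeometry.torsionOrder_eq_two_of_discr_lt hK.1 h4lt]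
    intro h2
    have := Nat.le_of_dvd two_pos h2
    omega
  obtain ⟨H, -⟩ := nonempty_heegnerDatum_holds (W.conductorNorm ℤ) K hK
    (exists_dvd_sq_sub_discr_holds (W.conductorNorm ℤ) K hK hHN).choose_spec
  obtain ⟨ι⟩ : Nonempty (K →+* ℂ) := inferInstance
  obtain ⟨P, hP⟩ := heegnerPointComplex_mem_range_map_holds (W.conductorNorm ℤ) W K hK hHN D H ι
  -- the minimal twist model: an X11a pair ON THE NON-SURJECTIVE LEAF, and its `≥`-half
  have hD0 : (NumberField.discr K : ℚ) ≠ 0 := by exact_mod_cast NumberField.discr_ne_zero K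
  haveI hEt : (W.quadraticTwist (NumberField.discr K : ℚ)).IsElliptic :=
    W.isElliptic_quadraticTwist hD0
  obtain ⟨Cd, hCd⟩ := hasGlobalMinimalModel_rat_holds (W.quadraticTwist (NumberField.discr K : ℚ))
  haveI : (Cd • W.quadraticTwist (NumberField.discr K : ℚ)).IsGloballyMinimal := hCd
  set Wd := Cd • W.quadraticTwist (NumberField.discr K : ℚ) with hWd_def
  have hWd : Cd • W.quadraticTwist (NumberField.discr K : ℚ) = Wd := rfl
  have hrd : Wd.analyticRank = 0 := by
    rw [hWd_def, analyticRank_smul]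
    exact analyticRank_eq_zero_of_entireLFunction_one_ne_zero _ hLt
  have hXa : ClassX11a Wd p := classX11a_twist_of_not_ram W p hX hnr K hK hHN Cd hWd hrd
  have hirrd : Wd.HasIrreducibleModPGaloisRep p := hXa.2.2.2.1
  have hnsd : ¬ Surj Wd p := not_surj_twist_model W p hD0 hns Cd hWd
  have hpN1 : p ∣ W.conductorNorm ℤ := dvd_conductorNorm_of_mult hmult
  have hsq := isSquare_discr_padic_of_heegner K hK hHN p hpN1
  have hvd : p ∣ padicValInt p Wd.minimalDiscriminantInt := by
    rw [padicValInt_minimalDiscriminantInt_twist_eq W p hD0 hsq Cd hWd]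
    exact hv
  obtain ⟨qd, hqd, hvqd⟩ :=
    AdditivePotMult.exists_printShape_lower_of_missingLowerBoundAt_rankZero (p := p) Wd hGZK hrd hirrd
      (hLtw Wd hXa hnsd hvd)
  have htam : padicValNat p Wd.tamagawaProduct = padicValNat p W.tamagawaProduct :=
    padicValNat_tamagawaProduct_twist_of_heegner W p hp5 K hK hHN Cd hWd
  have hu : padicValRat p (Cd.u : ℚ) = 0 :=
    AdditivePotMult.padicValRat_u_eq_zero_of_twist_minimal_of_split W p K hK hHp Cd hWd
  -- no p-torsion over K (irreducibility)
  have hbot := torsionBy_eq_bot_of_isImaginaryQuadratic_of_hasIrreducibleModPGaloisRep W K hK hp hirr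
  have hiv : ∀ x : (W.baseChange K).toAffine.Point, p • x = 0 → x = 0 := fun x hx ↦ by
    have hmem : x ∈ AddSubgroup.torsionBy (W.baseChange K).toAffine.Point ((p : ℕ) : ℤ) := by
      rw [mem_torsionBy_iff, natCast_zsmul]
      exact hx
    rw [hbot] at hmem
    exact hmem
  -- Darmon's conductor-1 datum on the frame (D, H.β, ι) and its bottom point
  obtain ⟨d₁⟩ := exists_kolyvaginHeegnerData_one (hD36 _ W K) hK D H.β ι H.dvd_sq_sub
  have hPd : d₁.toGeomPoints d₁.derivedPoint = toGeomPoints (W.baseChange K) P :=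
    KolyvaginBottom.toGeomPoints_derivedPoint_one_eq (hrec _ W K) hK hHN hP d₁ rfl
  -- descent to ℚ with weight t = ord_p ∏c (x11b3's sharp bookkeeping)
  refine missingUpperBoundAt_of_shaIndexBound_sharp W p (W.conductorNorm ℤ) K D H ι P (hGZ _ W K)
    (hKo _ W K) hGZK hmod hK hHN hP hp2 hc hμ hr hLt Wd Cd hWd hu htam le_rfl ⟨qd, hqd, hvqd⟩ ?_
  intro hfinK hPinf
  haveI : Finite (W.baseChange K).sha := hfinK
  obtain ⟨hrank, -⟩ := hKo (W.conductorNorm ℤ) W K hK hHN ⟨D, H, ι, hP⟩ hPinf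
  -- `−1 ∈ ρ̄_{E,p}(Γ_ℚ)` at the multiplicative `p ≥ 5` with `E[p]` irreducible (image-free), then Cha Rmk. 25 BY KERNEL at this frame
  have hneg : ∃ γ : absoluteGaloisGroup ℚ, ∀ T : geomTorsion W p, γ • T = -T :=
    ShimuraKolyvaginOfImage.exists_smul_eq_neg_of_mult_of_irr_of_five_le W p hp5 hmult hirr
  exact shaIndexBound_sharp_of_globalDivisibility_of_chaAt W K p D H.β ι P hPinf hrank hiv
    (fun M₀ hM₀div hM₀max t hglob ↦
      ModularHeegnerCha.cha_rmk25_upper_of_neg_of_casselsTate_of_frobeniusCongruence (hCT K) h372 hK h3 h4 hHN h2K hp2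
        hpN1 hirr hneg ι D d₁ hPd hPinf hM₀div hM₀max t hglob)
    (hJ K D H.β ι hK hdisc hHN hHp H.dvd_sq_sub hc)


/-! ### §2 The hybrid cut (§1′) on the Cha-free MAX road -/

/-- **THE HYBRID CUT OF CRUX 19065 (§1′ of `…HybridTwinLowerSupply`) WITHOUT CHA'S UPPER FACT.** As
`erratumRoadFive_nonSurjCorner_of_kolyZShaAn_of_kolyJMax_of_multiUpper_of_lowerLeafTwinDeep_of_twinMultDivisibility` (this seat g16, p611044) with the
binder `hChaU` (`Cha2005.rmk25_padicValNat_card_sha_primary_add_le_of_globalDivisibility`) REPLACED by {`hCT` : `casselsTate_levelInputs` at every `K`,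
`h372` : Gross 3.7 (2) image-free} — consumed by the Cha-free MAX road `missingUpperBoundAt_corner_of_jetchevDivisibility_of_twinLeafLower_of_casselsTate`
(§1 below, over corner3-p2 g11's kernel structure bound; the line's ONE-PRIME Friedberg–Hoffstein fact is spent on the auxiliary prime `2`, `p ∣ N` splitting
by Heegner). Proof VERBATIM otherwise: upper half by carrier profile (MAX road on `t = 0` ∕ mono-carrier
pairs, `hUmulti` on multi-carrier pairs), lower half trivial at `ord_p #Ш_an ≤ 0`, else `hZan` at a deep frame ∕ the unconditional conductor-1
certificate at a shallow one (`hChaL` stays). CONDITIONAL on every binder; does NOT close 19065; nothing booked; T7.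
[cite: Miller2011LMS, Def. 1.1] [cite: Cha2005, Thm. 21 and Rmk. 25 (pp. 173–175)] [cite: JetchevSkinnerWan2017, §7.4.1–7.4.2] -/
theorem erratumRoadFive_nonSurjCorner_of_kolyZShaAn_of_kolyJMax_of_multiUpper_of_lowerLeafTwinDeep_of_twinMultDivisibility_of_casselsTate
    (hGZ : ∀ (N : ℕ) [NeZero N] (W : WeierstrassCurve ℚ) (K : Type) [Field K] [NumberField K],
      gross_zagier N W K)
    (hKo : ∀ (N : ℕ) [NeZero N] (W : WeierstrassCurve ℚ) (K : Type) [Field K] [NumberField K],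
      kolyvagin N W K)
    (hWu : sha_dvd_analyticSha)
    (hGZK : rank_eq_analyticRank_of_analyticRank_le_one) (hmod : hasEntireLFunction_rat)
    (hnf : exists_isNewformOf) (hpar : nonempty_modularParametrizationData)
    (hFHs : friedbergHoffstein_exists_heegnerField_split_twist_ne_zero)
    (hMaz : mazur_not_dvd_maninConstant_of_odd)
    (hrec : ∀ (N : ℕ) [NeZero N] (W : WeierstrassCurve ℚ) (K : Type) [Field K] [NumberField K],
      heegnerPointOfConductor_one_galoisConj N W K)
    (hD36 : ∀ (N : ℕ) [NeZero N] (W : WeierstrassCurve ℚ) (K : Type) [Field K] [NumberField K],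
      phi_heegnerTau_mem_singularModuliField N W K)
    (hJs : thm61_splitMultiplicative) (hJn : thm61_nonsplitMultiplicative)
    (hGS : ∀ (W : WeierstrassCurve ℚ) [W.IsElliptic] [W.IsGloballyMinimal] (p : ℕ) [Fact p.Prime],
      greenberg_stevens (W := W) (p := p))
    (hChaL : Cha2005.rmk25_pow_dvd_card_sha_primary_of_certificate)
    (hCT : ∀ (K : Type) [Field K] [NumberField K], casselsTate_levelInputs K)
    (h372 : GrossLMS1991.prop37_2_frobeniusCongruence)
    -- the X11a lower half ONLY at NON-SURJECTIVE curves whose analytic `Ш` is NOT a `p`-adic unit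
    -- with `p ∈ {5,7}` and `p ∣ ord_p Δ_min(Wd)` (19064's registered `stub_lowerNonSurjDeep` restricted to the LEAF twins of item 19948)
    (h₄ℓ : ∀ (Wd : WeierstrassCurve ℚ) [Wd.IsElliptic] [Wd.IsGloballyMinimal] (p : ℕ) [Fact p.Prime],
      ClassX11a Wd p → ¬ Surj Wd p → (p = 5 ∨ p = 7) → p ∣ padicValInt p Wd.minimalDiscriminantInt →
      ¬ X11a.ShaAnUnit Wd p → Typed.MissingLowerBoundAt Wd p)
    -- Zₚᶜ ONLY at the corner pairs with `0 < ord_p #Ш(E)_an`, and only at the DEEP frames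
    (hZan : ∀ (W : WeierstrassCurve ℚ) [W.IsElliptic] [W.IsGloballyMinimal] (p : ℕ) [Fact p.Prime]
      (N : ℕ) [NeZero N] (K : Type) [Field K] [NumberField K]
      (Dt : ModularParametrizationData W N) (β : ℤ) (ι : K →+* ℂ),
      ClassX11b W p → ¬ Surj W p → (p = 5 ∨ p = 7) → p ∣ padicValInt p W.minimalDiscriminantInt →
      ¬ Ram W p → (∃ s : ℚ, shaAn W = (s : ℂ) ∧ 0 < padicValRat p s) →
      W.conductorNorm ℤ = N → IsImaginaryQuadratic K →
      4 < (NumberField.discr K).natAbs → SatisfiesHeegnerHypothesis N K →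
      SatisfiesHeegnerHypothesis p K → (4 * (N : ℤ)) ∣ β ^ 2 - NumberField.discr K → ¬ (p : ℤ) ∣ Dt.c →
      (∃ (d₁ : KolyvaginHeegnerData Dt β ι 1) (y : (W.baseChange K).toAffine.Point),
        WeierstrassCurve.Affine.Point.map (W' := W) (algebraMap K (ringClassField K ι 1)).toRatAlgHom y =
          d₁.derivedPoint ∧
        ∃ Q : (W.baseChange K).toAffine.Point, ((p ^ (padicValNat p W.tamagawaProduct + 1) : ℕ) : ℤ) • Q = y) →
      ∃ M : ℕ, M ≤ padicValNat p W.tamagawaProduct ∧ CertificateAt Dt β ι p M)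
    (hJmax : ∀ (W : WeierstrassCurve ℚ) [W.IsElliptic] [W.IsGloballyMinimal] [NeZero (W.conductorNorm ℤ)]
      (p : ℕ) [Fact p.Prime] (K : Type) [Field K] [NumberField K]
      (Dt : ModularParametrizationData W (W.conductorNorm ℤ)) (β : ℤ) (ι : K →+* ℂ),
      p ∣ W.tamagawaProduct →
      ClassX11b W p → ¬ Surj W p → (p = 5 ∨ p = 7) → p ∣ padicValInt p W.minimalDiscriminantInt →
      ¬ Ram W p → IsImaginaryQuadratic K → 4 < (NumberField.discr K).natAbs →
      SatisfiesHeegnerHypothesis (W.conductorNorm ℤ) K → SatisfiesHeegnerHypothesis p K →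
      (4 * (W.conductorNorm ℤ : ℤ)) ∣ β ^ 2 - NumberField.discr K → ¬ (p : ℤ) ∣ Dt.c →
      ∀ (v : HeightOneSpectrum (𝓞 ℚ)) (s : ℕ), s ≤ padicValNat p (W.tamagawaNumberAt v) →
        ∀ (n : ℕ) (d : KolyvaginHeegnerData Dt β ι n), Squarefree n →
          (∀ ℓ ∈ n.primeFactors, Zhang2014.IsKolyvaginPrime (W.conductorNorm ℤ) W K p ℓ ∧
            s ≤ Zhang2014.kolyvaginIndex W p ℓ) → PDiv d p s)
    (hUmulti : ∀ (W : WeierstrassCurve ℚ) [W.IsElliptic] [W.IsGloballyMinimal] (p : ℕ) [Fact p.Prime],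
      ClassX11b W p → ¬ Surj W p → (p = 5 ∨ p = 7) → p ∣ padicValInt p W.minimalDiscriminantInt →
      ¬ Ram W p → p ∣ W.tamagawaProduct →
      (∀ v : HeightOneSpectrum (𝓞 ℚ), padicValNat p (W.tamagawaNumberAt v) < padicValNat p W.tamagawaProduct) →
      Typed.MissingUpperBoundAt W p)
    (hdiv : ∀ (Wd : WeierstrassCurve ℚ) [Wd.IsElliptic] [Wd.IsGloballyMinimal] (p : ℕ) [Fact p.Prime],
      ClassX11a Wd p → ¬ Surj Wd p → (p = 5 ∨ p = 7) →
      p ∣ padicValInt p Wd.minimalDiscriminantInt → MultDivisibilityAt Wd p) :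
    Summit.BirchSwinnertonDyer.BirchSwinnertonDyer.Theses.ErratumRoadFive.NonSurjCorner := by
  intro W _ _ p _ hX hns h57 hv hnr
  have hp5 : 5 ≤ p := by rcases h57 with h | h <;> omega
  -- the X11a lower half at every NON-SURJECTIVE X11a LEAF twin at `p`: trivial at a unit `#Ш_an`, `h₄ℓ` otherwise
  have h₄ : ∀ (Wd : WeierstrassCurve ℚ) [Wd.IsElliptic] [Wd.IsGloballyMinimal], ClassX11a Wd p → ¬ Surj Wd p →
      p ∣ padicValInt p Wd.minimalDiscriminantInt → Typed.MissingLowerBoundAt Wd p := fun Wd _ _ hXa hnsd hvd ↦ by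
    by_cases hu : X11a.ShaAnUnit Wd p
    · obtain ⟨q, hq, hvq⟩ := hu
      exact ⟨q, hq, by rw [hvq]; exact_mod_cast Nat.zero_le _⟩
    · exact h₄ℓ Wd p hXa hnsd h57 hvd hu
  -- the Euler-system half of every non-surjective-leaf twin at this p, from the typed divisibility
  have hleafU : ∀ (Wd : WeierstrassCurve ℚ) [Wd.IsElliptic] [Wd.IsGloballyMinimal],
      ClassX11a Wd p → ¬ Surj Wd p → p ∣ padicValInt p Wd.minimalDiscriminantInt →
      Typed.MissingUpperBoundAt Wd p := fun Wd _ _ hXa hnsd hvd ↦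
    missingUpperBoundAt_of_classX11a_of_multDivisibilityAt hJs hJn hGZK hmod hpar Wd p (hGS Wd p) hXa
      (hdiv Wd p hXa hnsd h57 hvd)
  haveI : NeZero (W.conductorNorm ℤ) := ⟨(W.conductorNorm_pos_holds).ne'⟩
  -- the UPPER half, by CARRIER PROFILE (as in p579499)
  have hupper : Typed.MissingUpperBoundAt W p := by
    by_cases hcase : ¬ p ∣ W.tamagawaProduct ∨
        ∃ v : HeightOneSpectrum (𝓞 ℚ), padicValNat p W.tamagawaProduct ≤ padicValNat p (W.tamagawaNumberAt v)
    · refine missingUpperBoundAt_corner_of_jetchevDivisibility_of_twinLeafLower_of_casselsTate' hGZ hKo hGZK hmod hnf hFHs hMaz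
        hrec hD36 hCT h372 W p hX hns h57 hv hnr (fun Wd _ _ hXa hnsd hvd ↦ h₄ Wd hXa hnsd hvd) ?_
      intro _ K _ _ Dt β ι hK hdisc hHN hHp hβ hc s hs n d hn hℓ
      rcases hcase with htam | ⟨v, hvt⟩
      · exact Summit.BirchSwinnertonDyer.BirchSwinnertonDyer.Theorems.nonSurjCornerKolyJ_of_not_dvd_tamagawa W p K
          Dt β ι htam hX hns h57 hv hnr hK hdisc hHN hHp hβ hc s hs n d hn hℓ
      · by_cases htam : p ∣ W.tamagawaProduct
        · exact hJmax W p K Dt β ι htam hX hns h57 hv hnr hK hdisc hHN hHp hβ hc v s (hs.trans hvt) n d hn hℓ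
        · exact Summit.BirchSwinnertonDyer.BirchSwinnertonDyer.Theorems.nonSurjCornerKolyJ_of_not_dvd_tamagawa W p K
            Dt β ι htam hX hns h57 hv hnr hK hdisc hHN hHp hβ hc s hs n d hn hℓ
    · push Not at hcase
      exact hUmulti W p hX hns h57 hv hnr hcase.1 hcase.2
  -- the LOWER half: trivial when `ord_p #Ш(E)_an ≤ 0`; otherwise Zₚᶜ at the Hoffstein–Luo frame (deep or shallow)
  obtain ⟨s, hs, hsv⟩ := hupper
  by_cases hs0 : padicValRat p s ≤ 0
  · exact Typed.missingPPartAt_of_lower_of_upper W p (missingLowerBoundAt_of_shaAn_nonpos W p hs hs0) ⟨s, hs, hsv⟩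
  have hspos : ∃ s : ℚ, shaAn W = (s : ℂ) ∧ 0 < padicValRat p s := ⟨s, hs, lt_of_not_ge hs0⟩
  refine Typed.missingPPartAt_of_lower_of_upper W p ?_ ⟨s, hs, hsv⟩
  refine missingLowerBoundAt_of_classX11b_of_indexLowerBoundNoSurj_of_upperTwist hGZ hKo hWu hGZK
    hmod hnf hFHs hMaz W p hX hp5
    (fun N _ K _ _ Dt H ι P hN hK hdisc hHN hHp hLt hP hc hPinf ↦
      indexLowerBoundAt_corner_of_certificates hGZ hKo hmod hrec hD36 hChaL W p N K Dt H ι P hX hp5 hN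
        hK hdisc hHN hLt hP hPinf (by
          by_cases hdeep : ∃ (d₁ : KolyvaginHeegnerData Dt H.β ι 1) (y : (W.baseChange K).toAffine.Point),
              WeierstrassCurve.Affine.Point.map (W' := W) (algebraMap K (ringClassField K ι 1)).toRatAlgHom y =
                d₁.derivedPoint ∧
              ∃ Q : (W.baseChange K).toAffine.Point, ((p ^ (padicValNat p W.tamagawaProduct + 1) : ℕ) : ℤ) • Q = y
          · exact hZan W p N K Dt H.β ι hX hns h57 hv hnr hspos hN hK hdisc hHN hHp H.dvd_sq_sub hc hdeep
          · push Not at hdeep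
            exact nonSurjCornerKolyZ_of_bottom_not_pow_divisible' W p N K Dt H.β ι hX hns h57 hv hnr hN hK hdisc hHN
              hHp H.dvd_sq_sub hc (fun d₁ y hy hQ => by obtain ⟨Q, hQ⟩ := hQ; exact hdeep d₁ y hy Q hQ)))
    ?_
  intro K _ _ Wd _ _ Cd hK hHN hLt hWd hnsd
  have hD0 : (NumberField.discr K : ℚ) ≠ 0 := by exact_mod_cast NumberField.discr_ne_zero K
  haveI : (W.quadraticTwist (NumberField.discr K : ℚ)).IsElliptic := W.isElliptic_quadraticTwist hD0
  have hrd : Wd.analyticRank = 0 := by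
    rw [← hWd, analyticRank_smul]
    exact analyticRank_eq_zero_of_entireLFunction_one_ne_zero _ hLt
  have hXa : ClassX11a Wd p := classX11a_twist_of_not_ram W p hX hnr K hK hHN Cd hWd hrd
  have hpN : p ∣ W.conductorNorm ℤ := dvd_conductorNorm_of_mult hX.2.2.1
  have hsq := isSquare_discr_padic_of_heegner K hK hHN p hpN
  have hvd : p ∣ padicValInt p Wd.minimalDiscriminantInt := by
    rw [padicValInt_minimalDiscriminantInt_twist_eq W p hD0 hsq Cd hWd]
    exact hv
  exact hleafU Wd hXa hnsd hvd

end Summit.BirchSwinnertonDyer.Rank1Residual.X11b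

end
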